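import Literature.NumberTheory.Automorphic.ArchWeylDiscriminant            -- ★ road D1′a (p836187 + ED. 2): `archWeylDiscr(_diagonal)`, `archWeylDiscr_ne_zero_iff`, `matrix_discr_diagonal`
import Literature.NumberTheory.Automorphic.UnitaryGroupArchimedeanPlaces    -- ★ `archPiEquivCM`, `archLocal`, `archAt`, `mem_arch_iff_forall`, `mixedSpace_ext`
import Mathlib.Analysis.SpecialFunctions.Complex.Circle                    -- `Circle.exp`, `Circle.exp_eq_exp`, `Circle.exp_arg`
import Mathlib.LinearAlgebra.Matrix.Charpoly.Disc                          -- `Matrix.discr`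
import HarnessLib

/-!
# The diagonal torus of `U(diag α)(L⁺ ⊗ ℝ)` in circle ∕ angle coordinates, its Weyl discriminant and its regular set
# (road D1′b: Rogawski 1990 §8.4 pp. 126–127, the torus `T` and the angles `θ₁, θ₂, θ₃` of the limit formulas; Bröcker–tom Dieck IV (3.1))

Topic `NumberTheory/Automorphic`; namespaces `Literature.NumberTheory.Automorphic` (§1′) and `….UnitaryGroup` (§§2–5).  TWO honest definitions with bodies
(`UnitaryGroup.circleDiagonal`, `UnitaryGroup.archDiagTorus` — both `MonoidHom`s built from Mathlib∕★ pieces) + theorems; no instance, no notation, no attribute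
beyond `@[simp]` on one `rfl` coe lemma, no axiom, no `sorry`.  Cell `pub/hodgecm-mathlib`, ENGINE T1 (crux H413 = `stmt-HodgeConjecture-24833`); floor-1
preparation, count-neutral, under books rows #111 (S-d) (ROAD-Sd §3 (T-a): «parametrise `T_reg` by angles; the variable every limit formula differentiates in»)
and #88 (ST-∞) (CENSUS-88-arch v2 §5 road D1′); author F0P3a-p06 (g9) on LEAD DESK WORD T6-66 (2) (F0P3a-plan (g7), 2026-08-31).  Docks BY NAME into road
D1′a ★ `archWeylDiscr` (F0P3a-p02 (g8), p836187).

WHAT IS PROVED.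
* §1′ `isUnit_matrix_discr_diagonal_iff` — the units form of ★ `Literature.LinearAlgebra.Matrix.matrix_discr_diagonal` (road D1′a ED. 2, F0P3a-p02: `disc(χ_{diag d}) =
  (−1)^{N(N−1)/2} ∏_i ∏_{j≠i} (d_i − d_j)` over every commutative ring; LEAD T6-73 (1) ruling (α): the generic identities live there, this file imports them).
* §2 (local, `GL_N(ℂ)`) `UnitaryGroup.circleDiagonal : (Fin N → Circle) →* GL (Fin N) ℂ`, `z ↦ diag(z)`; injective, continuous; **`diag(z) ∈ U(diag e)(ℂ)` for every
  diagonal form** (`circleDiagonal_mem_unitaryGroupOfForm_diagonal`), in particular `∈ archLocal L N (diagonal α) w = U(σ_w diag α)(ℂ)`.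
* §3 (global, CM field `L`) **`UnitaryGroup.archDiagTorus L N α : ({w ∕∕ IsComplex w} → Fin N → Circle) →* UnitaryGroup.arch L⁺ L c N (diagonal α)`**, `z ↦ t(z)`,
  with `archAt_archDiagTorus` (the `w`-component is `diag(z_w)`), `coe_archDiagTorus_apply`∕`coe_archDiagTorus_eq_diagonal` (the underlying matrix is
  `diag((0, (z_{w,i})_w))`), `archDiagTorus_injective`, `continuous_archDiagTorus`.
* §4 (docking D1′a ★ `archWeylDiscr_diagonal`) **`archWeylDiscr_archDiagTorus`**: `|D(t(z))|_∞ = ∏_w ∏_i ∏_{j≠i} |z_{w,i} − z_{w,j}|` and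
  **`isRegularElt_archDiagTorus_iff`**: `t(z)` is regular iff `z_w` is injective at every complex place `w`.
* §5 **`exists_archDiagTorus_eq_of_coe_eq_diagonal`**: for non-degenerate `diag(α)` EVERY diagonal element of `U(diag α)(L⁺ ⊗ ℝ)` is some `t(z)` (the range is the
  whole diagonal subgroup); angle coordinates (def-free, on the term `fun w i => Circle.exp (θ w i)`): `continuous_archDiagTorus_exp`,
  `archDiagTorus_exp_add_int_mul_two_pi` (`2π`-periodicity), `exists_angles_eq` (onto), **`isRegularElt_archDiagTorus_exp_iff`** (regular iff the angles are
  pairwise distinct mod `2π` at every place).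
* §6 **`rationalToArch_eq_archDiagTorus_const`**: a rational scalar `g = ζ•1 ∈ U(diag α)(L⁺)` with `|σ_w ζ| = 1` maps to the torus element with CONSTANT
  coordinates `z_{w,i} = σ_w(ζ)` (★ `rationalToArch`; ★ `cmRationalToArch` = it after `subgroupCongr`) — the `γ₀ = ζ•1` endpoint of the (S-d) letter's
  central-value clause; `norm_embedding_eq_one_of_complexConj_mul_self` (`ζ̄ζ = 1 ⇒ |σ_w ζ| = 1`).
NOT HERE (next bricks): the Haar measure `dθ` on the torus and the Weyl integration formula on `G_∞`; any orbital integral.  HONEST LABEL: HC_CM is proved only modulo the printed citations until rung 0 closes; this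
file is linear algebra ∕ topology of a torus and pays nothing by itself.

## References
* [Rogawski1990] J. D. Rogawski, *Automorphic Representations of Unitary Groups in Three Variables*, Ann. of Math. Stud. 123 (1990): §3.1 p. 19 (regular
  elements), §4.9 p. 54 (`D_G(γ) = |∏(1 − α(γ))|^{1/2}` on a maximal torus), §8.4 pp. 126–127 (the torus angles `θ₁, θ₂, θ₃`, `′Δ(γ) = ∏(1 − e^{i(θ_j − θ_i)})`,
  Harish-Chandra's limit formula) — held e-text `book:rogawski1990-automorphic-representations-unitary-groups-three-variables` chunks p0059, p0126 read.
* [BrockerTomDieck1985] Th. Bröcker, T. tom Dieck, *Representations of Compact Lie Groups*, GTM 98 (1985), IV (3.1) (the diagonal maximal torus of `U(n)`).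
* [BasuPollackRoy2006] S. Basu, R. Pollack, M.-F. Roy, *Algorithms in Real Algebraic Geometry*, 2nd ed. (2006), Ch. 4 §4.1–4.3 (discriminants, resultants).
* [HarishChandra1957] Harish-Chandra, *A formula for semisimple Lie groups*, Amer. J. Math. 79 (1957) (the discriminant `D(γ)`).
* [BorelJacquet1979] A. Borel, H. Jacquet, *Automorphic forms and automorphic representations*, PSPM 33.1 (1979), §4.1 (`G_∞ = ∏_v G(F_v)`).
-/

set_option autoImplicit false

noncomputable section

open Polynomial Finset NumberField NumberField.InfinitePlace NumberField.mixedEmbedding Literature.LinearAlgebra.Matrix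
open scoped Matrix MatrixGroups ComplexConjugate

namespace Literature.NumberTheory.Automorphic

/-! ## §1′ Units form of the diagonal discriminant (over ★ `Literature.LinearAlgebra.Matrix.matrix_discr_diagonal`, road D1′a ED. 2) -/

section Generic

variable {R : Type*} [CommRing R] {n : Type*} [Fintype n] [DecidableEq n]

/-- `disc(χ_{diag(d)})` is a unit iff every difference `d_i − d_j`, `i ≠ j`, is a unit — units form of ★ `matrix_discr_diagonal`
(`disc(χ_{diag d}) = (−1)^{N(N−1)/2} ∏_i ∏_{j≠i} (d_i − d_j)`, F0P3a-p02); over `E ⊗ ℝ`: iff the eigenvalues are distinct at EVERY place (★ `isUnit_mixedSpace_iff`).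
[cite: BasuPollackRoy2006, Ch. 4 §4.1 Prop. 4.3, pp. 101–105] [cite: Rogawski1990, §3.1 p. 19] -/
theorem isUnit_matrix_discr_diagonal_iff (d : n → R) :
    IsUnit (Matrix.discr (Matrix.diagonal d)) ↔ ∀ i j, i ≠ j → IsUnit (d i - d j) := by
  rw [matrix_discr_diagonal, IsUnit.mul_iff, and_iff_right ((isUnit_one.neg).pow _), IsUnit.prod_univ_iff]
  simp only [IsUnit.prod_iff, Finset.mem_erase, Finset.mem_univ, and_true]
  exact ⟨fun h i j hij => h i j (Ne.symm hij), fun h i j hji => h i j (Ne.symm hji)⟩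

end Generic

/-! ## §2 The local torus `diag(z) ∈ GL_N(ℂ)`, `z ∈ (S¹)^N` -/

namespace UnitaryGroup

section Local

variable (N : ℕ)

/-- **`z ↦ diag(z₁, …, z_N) ∈ GL_N(ℂ)` for `z ∈ (S¹)^N`**, as a monoid homomorphism (Mathlib `Circle.toUnits`, `MulEquiv.piUnits`, `Matrix.diagonalRingHom`):
the diagonal torus `Δ(N)` of `U(N)` ⊂ `GL_N(ℂ)` in coordinates (cf. ★ `Literature.LinearAlgebra.Matrix.diagonalTorusHom` into Mathlib's `Matrix.unitaryGroup`;
here the target is `GL_N(ℂ)`, where the tree's `U(σ_w H)(ℂ) = archLocal` lives). [cite: BrockerTomDieck1985, IV (3.1) (p0160)] -/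
def circleDiagonal : (Fin N → Circle) →* GL (Fin N) ℂ :=
  (Units.map (Matrix.diagonalRingHom (Fin N) ℂ : (Fin N → ℂ) →+* Matrix (Fin N) (Fin N) ℂ).toMonoidHom).comp
    (MulEquiv.piUnits.symm.toMonoidHom.comp (MonoidHom.compLeft Circle.toUnits (Fin N)))

/-- Underlying matrix of `circleDiagonal z`: `diagonal z` (definitional). [cite: BrockerTomDieck1985, IV (3.1) (p0160)] -/
@[simp] theorem coe_circleDiagonal (z : Fin N → Circle) :
    ((circleDiagonal N z : GL (Fin N) ℂ) : Matrix (Fin N) (Fin N) ℂ) = Matrix.diagonal fun i => (z i : ℂ) := rfl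

/-- `circleDiagonal` is injective. [cite: BrockerTomDieck1985, IV (3.1) (p0160)] -/
theorem circleDiagonal_injective : Function.Injective (circleDiagonal N) := by
  intro z z' h
  funext i
  have h1 := congrArg (fun g : GL (Fin N) ℂ => (g : Matrix (Fin N) (Fin N) ℂ) i i) h
  simp only [coe_circleDiagonal, Matrix.diagonal_apply_eq] at h1
  exact Circle.ext h1

/-- `circleDiagonal` is continuous (into `GL_N(ℂ)` with its units topology). [cite: BrockerTomDieck1985, IV (3.1) (p0160)] -/
theorem continuous_circleDiagonal : Continuous (circleDiagonal N) := by
  refine Units.continuous_iff.mpr ⟨?_, ?_⟩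
  · exact (continuous_pi fun i => continuous_subtype_val.comp (continuous_apply i)).matrix_diagonal
  · have h : (fun z : Fin N → Circle => ((circleDiagonal N z)⁻¹ : GL (Fin N) ℂ).val) =
        fun z => Matrix.diagonal fun i => (((z i)⁻¹ : Circle) : ℂ) := by
      funext z; rw [← map_inv]; rfl
    rw [h]
    have hc : Continuous fun z : Fin N → Circle => fun i => (((z i)⁻¹ : Circle) : ℂ) :=
      continuous_pi fun i => continuous_subtype_val.comp ((continuous_apply i).inv)
    exact hc.matrix_diagonal

/-- **`diag(z) ∈ U(diag(e))(ℂ)`** (`z ∈ (S¹)^N`) for EVERY diagonal form `diag(e)` over `ℂ` — `z̄_i e_i z_i = e_i`; no signature or non-degeneracy hypothesis.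
[cite: BrockerTomDieck1985, IV (3.1) (p0160)] [cite: Rogawski1990, §4.9 p. 54] -/
theorem circleDiagonal_mem_unitaryGroupOfForm_diagonal (z : Fin N → Circle) (e : Fin N → ℂ) :
    circleDiagonal N z ∈ unitaryGroupOfForm (starRingEnd ℂ) (Matrix.diagonal e) := by
  rw [mem_unitaryGroupOfForm_iff, coe_circleDiagonal, Matrix.diagonal_map (map_zero _), Matrix.diagonal_transpose,
    Matrix.diagonal_mul_diagonal, Matrix.diagonal_mul_diagonal]
  congr 1
  funext i
  -- `z̄_i z_i = 1` on the circle (★ `BallModel.circle_conj_mul_self'` states the same; not imported — hyperbolic-geometry closure)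
  have hz : starRingEnd ℂ (z i : ℂ) * (z i : ℂ) = 1 := by
    rw [← Complex.normSq_eq_conj_mul_self, Circle.normSq_coe, Complex.ofReal_one]
  rw [mul_comm (starRingEnd ℂ (z i : ℂ)) (e i), mul_assoc, hz, mul_one]

end Local

/-! ## §3 The diagonal torus of `U(diag α)(L⁺ ⊗ ℝ)` (CM field `L`) -/

section CM

variable (L : Type) [Field L] [NumberField L] [IsCMField L] (N : ℕ) (α : Fin N → L)

omit [NumberField L] [IsCMField L] in
/-- `diag(z_w) ∈ U(σ_w diag(α))(ℂ) = archLocal L N (diag α) w` at every complex place `w` (`σ_w diag(α) = diag(σ_w α)`). [cite: Rogawski1990, §4.9 p. 54]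
[cite: BorelJacquet1979, §4.1] -/
theorem circleDiagonal_mem_archLocal_diagonal (w : {w : InfinitePlace L // IsComplex w}) (z : Fin N → Circle) :
    circleDiagonal N z ∈ archLocal L N (Matrix.diagonal α) w := by
  rw [mem_archLocal_iff, Matrix.diagonal_map (map_zero _)]
  exact mem_unitaryGroupOfForm_iff.mp (circleDiagonal_mem_unitaryGroupOfForm_diagonal N z _)

/-- **THE DIAGONAL TORUS `T_∞` OF `G_∞ = U(diag α)(L⁺ ⊗ ℝ) = ∏_{w} U(σ_w diag α)(ℂ)` IN CIRCLE COORDINATES**: the monoid homomorphism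
`z = (z_{w,i}) ↦ t(z)`, `(S¹)^{W × N} →* UnitaryGroup.arch L⁺ L c N (diagonal α)` (`W` = complex places of the CM field `L`), whose `w`-component is
`diag(z_{w,1}, …, z_{w,N})` (`archAt_archDiagTorus`) — assembled through ★ `archPiEquivCM : U(H)(L ⊗ ℝ) ≃ₜ* ∏_w U(σ_w H)(ℂ)`.  For `H′ = diag(α)` anisotropic this
is a maximal torus of the compact `G′_∞ = U(3)^W`; for the quasi-split `Φ₃ ∼ diag(1, 1, −1)` it is the COMPACT Cartan of `U(2,1)^W`; print's torus `T` with
angle coordinates `θ₁, θ₂, θ₃` in the limit formulas. [cite: Rogawski1990, §8.4 pp. 126–127; §4.9 p. 54] [cite: BrockerTomDieck1985, IV (3.1) (p0160)] -/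
def archDiagTorus :
    ({w : InfinitePlace L // IsComplex w} → Fin N → Circle) →*
      arch (↥(maximalRealSubfield L)) L (IsCMField.complexConj L) N (Matrix.diagonal α) :=
  (archPiEquivCM N L (Matrix.diagonal α)).symm.toMulEquiv.toMonoidHom.comp
    (MonoidHom.pi fun w =>
      ((circleDiagonal N).codRestrict (archLocal L N (Matrix.diagonal α) w)
          (circleDiagonal_mem_archLocal_diagonal L N α w)).comp
        (Pi.evalMonoidHom (fun _ : {w : InfinitePlace L // IsComplex w} => Fin N → Circle) w))

/-- **The `w`-component of `t(z)` is `diag(z_w)`** (★ `archAt`, ★ `archPiEquivCM`). [cite: Rogawski1990, §8.4 p. 126] [cite: BorelJacquet1979, §4.1] -/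
theorem archAt_archDiagTorus (z : {w : InfinitePlace L // IsComplex w} → Fin N → Circle)
    (w : {w : InfinitePlace L // IsComplex w}) :
    ((archAt (↥(maximalRealSubfield L)) L (IsCMField.complexConj L) N (Matrix.diagonal α) w
        (complexConj_smul_infinitePlace L w.1) (IsCMField.complexConj_ne_one L) (archDiagTorus L N α z) :
        archLocal L N (Matrix.diagonal α) w) : GL (Fin N) ℂ) = circleDiagonal N (z w) := by
  change ((archPiEquivCM N L (Matrix.diagonal α) ((archPiEquivCM N L (Matrix.diagonal α)).symm _) w :
    archLocal L N (Matrix.diagonal α) w) : GL (Fin N) ℂ) = _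
  rw [ContinuousMulEquiv.apply_symm_apply]
  rfl

/-- Entries of `t(z)`: the `w`-coordinate of the `(i, j)` entry is `diag(z_w)_{ij}`. [cite: Rogawski1990, §8.4 p. 126] -/
theorem coe_archDiagTorus_apply (z : {w : InfinitePlace L // IsComplex w} → Fin N → Circle) (i j : Fin N)
    (w : {w : InfinitePlace L // IsComplex w}) :
    ((((archDiagTorus L N α z : arch (↥(maximalRealSubfield L)) L (IsCMField.complexConj L) N (Matrix.diagonal α)) :
        GL (Fin N) (mixedSpace L)) : Matrix (Fin N) (Fin N) (mixedSpace L)) i j).2 w =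
      Matrix.diagonal (fun i => (z w i : ℂ)) i j := by
  have h := congrArg (fun g : GL (Fin N) ℂ => (g : Matrix (Fin N) (Fin N) ℂ) i j) (archAt_archDiagTorus L N α z w)
  simpa only [coe_archAt_apply, coe_circleDiagonal] using h

/-- **`t(z)` is the diagonal matrix `diag(d₁, …, d_N) ∈ GL_N(L ⊗ ℝ)`, `d_i = (0, (z_{w,i})_w)`** (no real places: `L` is CM, ★ `mixedSpace_ext`).
[cite: Rogawski1990, §8.4 p. 126] [cite: BorelJacquet1979, §4.1] -/
theorem coe_archDiagTorus_eq_diagonal (z : {w : InfinitePlace L // IsComplex w} → Fin N → Circle) :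
    (((archDiagTorus L N α z : arch (↥(maximalRealSubfield L)) L (IsCMField.complexConj L) N (Matrix.diagonal α)) :
        GL (Fin N) (mixedSpace L)) : Matrix (Fin N) (Fin N) (mixedSpace L)) =
      Matrix.diagonal fun i => ((0 : {w : InfinitePlace L // IsReal w} → ℝ), fun w => (z w i : ℂ)) := by
  ext i j : 1
  refine mixedSpace_ext (↥(maximalRealSubfield L)) L (IsCMField.complexConj L) (IsCMField.complexConj_ne_one L)
    (complexConj_smul_infinitePlace L) fun w => ?_
  rw [coe_archDiagTorus_apply]
  by_cases hij : i = j
  · subst hij; simp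
  · simp [hij]

/-- `z ↦ t(z)` is injective. [cite: BrockerTomDieck1985, IV (3.1) (p0160)] -/
theorem archDiagTorus_injective : Function.Injective (archDiagTorus L N α) := by
  intro z z' h
  funext w
  apply circleDiagonal_injective N
  rw [← archAt_archDiagTorus L N α z w, ← archAt_archDiagTorus L N α z' w, h]

/-- `z ↦ t(z)` is continuous. [cite: BorelJacquet1979, §4.1] -/
theorem continuous_archDiagTorus : Continuous (archDiagTorus L N α) := by
  refine (archPiEquivCM N L (Matrix.diagonal α)).symm.continuous.comp ?_
  refine continuous_pi fun w => ?_
  exact ((continuous_circleDiagonal N).comp (continuous_apply w)).subtype_mk _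

end CM

/-! ## §4 The Weyl discriminant and regularity on the torus (docking ★ `archWeylDiscr`, road D1′a) -/

section CM2

variable (L : Type) [Field L] [NumberField L] [IsCMField L] (N : ℕ) (α : Fin N → L)

open scoped Classical in
/-- **`|D(t(z))|_∞ = ∏_w ∏_i ∏_{j ≠ i} |z_{w,i} − z_{w,j}|` — THE ARCHIMEDEAN WEYL DISCRIMINANT ON THE TORUS** (★ `archWeylDiscr` of road D1′a, p836187;
`= ∏_w ∏_{i<j} |z_{w,i} − z_{w,j}|² = ∏_w D_{G_w}(t(z)_w)²` with print's `D_G(γ) = |∏_α (1 − α(γ))|^{1/2}`, since `|1 − z_j/z_i| = |z_i − z_j|` on `S¹`; the sign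
`(−1)^{N(N−1)/2}` of ★ `matrix_discr_diagonal` is killed by the place norms — ★ `archWeylDiscr_diagonal`). [cite: Rogawski1990, §4.9 p. 54; §8.4 p. 126] [cite: HarishChandra1957, §1] -/
theorem archWeylDiscr_archDiagTorus (z : {w : InfinitePlace L // IsComplex w} → Fin N → Circle) :
    archWeylDiscr ((((archDiagTorus L N α z : arch (↥(maximalRealSubfield L)) L (IsCMField.complexConj L) N
        (Matrix.diagonal α)) : GL (Fin N) (mixedSpace L)) : Matrix (Fin N) (Fin N) (mixedSpace L))) =
      ∏ w : {w : InfinitePlace L // IsComplex w}, ∏ i, ∏ j ∈ univ.erase i, ‖(z w i : ℂ) - z w j‖ := by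
  rw [coe_archDiagTorus_eq_diagonal, archWeylDiscr_diagonal]
  have hall : ∀ w : InfinitePlace L, IsComplex w := IsTotallyComplex.isComplex
  refine (Fintype.prod_equiv (Equiv.subtypeUnivEquiv hall) _ _ fun w => ?_).symm
  refine Finset.prod_congr rfl fun i _ => Finset.prod_congr rfl fun j _ => ?_
  rw [Equiv.subtypeUnivEquiv_apply, normAtPlace_apply_of_isComplex w.2]
  rfl

open scoped Classical in
/-- **`t(z)` IS REGULAR iff at every complex place `w` the `N` circle coordinates `z_{w,1}, …, z_{w,N}` are pairwise distinct** (★ `archWeylDiscr_ne_zero_iff`: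
regular ⇔ `|D|_∞ ≠ 0`) — the set `T_reg` over which every «`γ → γ₀` through regular `γ`» limit is taken. [cite: Rogawski1990, §3.1 p. 19; §8.4 p. 126] -/
theorem isRegularElt_archDiagTorus_iff (z : {w : InfinitePlace L // IsComplex w} → Fin N → Circle) :
    Literature.NumberTheory.Rogawski1990.IsRegularElt (((archDiagTorus L N α z : arch (↥(maximalRealSubfield L)) L
        (IsCMField.complexConj L) N (Matrix.diagonal α)) : GL (Fin N) (mixedSpace L))) ↔
      ∀ w : {w : InfinitePlace L // IsComplex w}, Function.Injective (z w) := by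
  rw [← archWeylDiscr_ne_zero_iff, archWeylDiscr_archDiagTorus]
  simp only [Finset.prod_ne_zero_iff, Finset.mem_univ, Finset.mem_erase, forall_const, ne_eq, and_true,
    norm_eq_zero, sub_eq_zero, Circle.coe_inj]
  constructor
  · intro h w i j hij
    by_contra hne
    exact h w i j (fun e => hne e.symm) hij
  · intro h w i j hji hij
    exact hji (h w hij).symm


/-! ## §5 The torus is ALL of the diagonal subgroup of `U(diag α)(L⁺ ⊗ ℝ)`; angle coordinates `z_{w,i} = e^{iθ_{w,i}}` -/

/-- **EVERY DIAGONAL ELEMENT OF `U(diag α)(L⁺ ⊗ ℝ)` IS A TORUS ELEMENT `t(z)`** when `diag(α)` is non-degenerate (`α_i ≠ 0`): unitarity forces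
`|d_{i,w}|² σ_w(α_i) = σ_w(α_i)`, i.e. `|d_{i,w}| = 1`, at every complex place.  So `range (archDiagTorus L N α)` is exactly the diagonal subgroup — the
maximal torus `Δ` of `U(N)` at the definite places. [cite: BrockerTomDieck1985, IV (3.1) (p0160)] [cite: Rogawski1990, §4.9 p. 54] -/
theorem exists_archDiagTorus_eq_of_coe_eq_diagonal (hα : ∀ i, α i ≠ 0)
    (g : arch (↥(maximalRealSubfield L)) L (IsCMField.complexConj L) N (Matrix.diagonal α)) (d : Fin N → mixedSpace L)
    (hg : ((g : GL (Fin N) (mixedSpace L)) : Matrix (Fin N) (Fin N) (mixedSpace L)) = Matrix.diagonal d) :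
    ∃ z : {w : InfinitePlace L // IsComplex w} → Fin N → Circle, archDiagTorus L N α z = g := by
  -- the complex coordinates of the diagonal entries lie on the unit circle
  have hnorm : ∀ (w : {w : InfinitePlace L // IsComplex w}) (i : Fin N), ‖(d i).2 w‖ = 1 := by
    intro w i
    have hmem := (mem_arch_iff_forall (↥(maximalRealSubfield L)) L (IsCMField.complexConj L) N (Matrix.diagonal α)
      (IsCMField.complexConj_ne_one L) (complexConj_smul_infinitePlace L) (g : GL (Fin N) (mixedSpace L))).mp g.2 w
    rw [mem_archLocal_iff] at hmem
    have hval : ((Matrix.GeneralLinearGroup.map (evalC L w) (g : GL (Fin N) (mixedSpace L)) : GL (Fin N) ℂ) :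
        Matrix (Fin N) (Fin N) ℂ) = Matrix.diagonal fun i => (d i).2 w := by
      change ((g : GL (Fin N) (mixedSpace L)) : Matrix (Fin N) (Fin N) (mixedSpace L)).map (evalC L w) = _
      rw [hg, Matrix.diagonal_map (map_zero _)]
      rfl
    rw [hval, Matrix.diagonal_map (map_zero _), Matrix.diagonal_map (map_zero _), Matrix.diagonal_transpose,
      Matrix.diagonal_mul_diagonal, Matrix.diagonal_mul_diagonal] at hmem
    have hi := congrFun (Matrix.diagonal_injective hmem) i
    have hαi : w.1.embedding (α i) ≠ 0 := (_root_.map_ne_zero _).mpr (hα i)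
    have h1 : starRingEnd ℂ ((d i).2 w) * (d i).2 w = 1 := by
      have h2 : (starRingEnd ℂ ((d i).2 w) * (d i).2 w) * w.1.embedding (α i) = 1 * w.1.embedding (α i) := by
        rw [one_mul, mul_assoc, mul_comm ((d i).2 w), ← mul_assoc]; exact hi
      exact mul_right_cancel₀ hαi h2
    have h3 : ‖(d i).2 w‖ ^ 2 = 1 := by
      have := congrArg (fun x : ℂ => ‖x‖) h1
      simpa [norm_mul, Complex.norm_conj, sq] using this
    nlinarith [norm_nonneg ((d i).2 w), h3]
  refine ⟨fun w i => ⟨(d i).2 w, mem_sphere_zero_iff_norm.mpr (hnorm w i)⟩, ?_⟩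
  apply Subtype.ext
  apply Units.ext
  refine Matrix.ext fun i j => mixedSpace_ext (↥(maximalRealSubfield L)) L (IsCMField.complexConj L)
    (IsCMField.complexConj_ne_one L) (complexConj_smul_infinitePlace L) fun w => ?_
  rw [coe_archDiagTorus_apply, hg]
  by_cases hij : i = j
  · subst hij; simp
  · simp [hij]

/-- **Angle coordinates**: `θ = (θ_{w,i}) ↦ t(e^{iθ})` is continuous (Mathlib `Circle.exp : C(ℝ, S¹)`); print's `γ = diag(e^{iθ₁}, e^{iθ₂}, e^{iθ₃})`, the variable
of the differential operator `ω` in the limit formulas. [cite: Rogawski1990, §8.4 pp. 126–127] -/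
theorem continuous_archDiagTorus_exp :
    Continuous fun θ : {w : InfinitePlace L // IsComplex w} → Fin N → ℝ =>
      archDiagTorus L N α fun w i => Circle.exp (θ w i) :=
  (continuous_archDiagTorus L N α).comp
    (continuous_pi fun w => continuous_pi fun i => Circle.exp.continuous.comp ((continuous_apply i).comp (continuous_apply w)))

/-- `t(e^{iθ})` is `2π`-periodic in every angle `θ_{w,i}` (Mathlib `Circle.exp_eq_exp`). [cite: Rogawski1990, §8.4 p. 126] -/
theorem archDiagTorus_exp_add_int_mul_two_pi (θ : {w : InfinitePlace L // IsComplex w} → Fin N → ℝ)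
    (m : {w : InfinitePlace L // IsComplex w} → Fin N → ℤ) :
    (archDiagTorus L N α fun w i => Circle.exp (θ w i + m w i * (2 * Real.pi))) =
      archDiagTorus L N α fun w i => Circle.exp (θ w i) := by
  congr 1
  funext w i
  exact Circle.exp_eq_exp.mpr ⟨m w i, rfl⟩

omit [NumberField L] [IsCMField L] in
/-- Every family of circle coordinates has angles: `z_{w,i} = e^{iθ_{w,i}}` with `θ_{w,i} = arg z_{w,i}` (Mathlib `Circle.exp_arg`), so `θ ↦ t(e^{iθ})` is ONTO
the torus. [cite: Rogawski1990, §8.4 p. 126] -/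
theorem exists_angles_eq (z : {w : InfinitePlace L // IsComplex w} → Fin N → Circle) :
    ∃ θ : {w : InfinitePlace L // IsComplex w} → Fin N → ℝ, (fun w i => Circle.exp (θ w i)) = z :=
  ⟨fun w i => Complex.arg (z w i), funext fun w => funext fun i => Circle.exp_arg (z w i)⟩

open scoped Classical in
/-- **`t(e^{iθ})` IS REGULAR iff at every complex place the angles `θ_{w,1}, …, θ_{w,N}` are pairwise distinct modulo `2π`** — the complement of the root
hyperplanes `θ_i ≡ θ_j`, on which print's `′Δ(γ) = ∏ (1 − e^{i(θ_j − θ_i)})` vanishes. [cite: Rogawski1990, §8.4 p. 126; §3.1 p. 19] -/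
theorem isRegularElt_archDiagTorus_exp_iff (θ : {w : InfinitePlace L // IsComplex w} → Fin N → ℝ) :
    Literature.NumberTheory.Rogawski1990.IsRegularElt (((archDiagTorus L N α (fun w i => Circle.exp (θ w i)) :
        arch (↥(maximalRealSubfield L)) L (IsCMField.complexConj L) N (Matrix.diagonal α)) : GL (Fin N) (mixedSpace L))) ↔
      ∀ (w : {w : InfinitePlace L // IsComplex w}) (i j : Fin N), i ≠ j → ¬ ∃ m : ℤ, θ w i = θ w j + m * (2 * Real.pi) := by
  rw [isRegularElt_archDiagTorus_iff]
  refine forall_congr' fun w => ⟨fun h i j hij hm => hij (h (Circle.exp_eq_exp.mpr hm)), fun h i j hij => ?_⟩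
  by_contra hne
  exact h i j hne (Circle.exp_eq_exp.mp hij)

/-! ## §6 Central (scalar) elements `ζ•1 ⊗ 1` lie on the torus with constant coordinates `σ_w(ζ)` -/

/-- **Central (scalar) elements lie on the torus**: if `g ∈ U(diag α)(L⁺)` is the scalar `ζ•1` with `|σ_w(ζ)| = 1` at every complex place, then
`g ⊗ 1 = t(z)` with the CONSTANT coordinates `z_{w,i} = σ_w(ζ)` (★ `rationalToArch`; the `γ₀ = ζ•1` of the (S-d) letter's central-value clause, the endpoint
`θ_{w,1} = θ_{w,2} = θ_{w,3}` of the limit `γ → γ₀` along the torus). [cite: Rogawski1990, §14.5 p. 239; §8.4 p. 126] [cite: BorelJacquet1979, §4.1] -/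
theorem rationalToArch_eq_archDiagTorus_const (ζ : L) (hζ : ∀ w : {w : InfinitePlace L // IsComplex w}, ‖w.1.embedding ζ‖ = 1)
    (g : rational (↥(maximalRealSubfield L)) L (IsCMField.complexConj L) N (Matrix.diagonal α))
    (hg : ((g : GL (Fin N) L) : Matrix (Fin N) (Fin N) L) = ζ • (1 : Matrix (Fin N) (Fin N) L)) :
    rationalToArch (↥(maximalRealSubfield L)) L (IsCMField.complexConj L) N (Matrix.diagonal α) g =
      archDiagTorus L N α (fun w _ => ⟨w.1.embedding ζ, mem_sphere_zero_iff_norm.mpr (hζ w)⟩) := by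
  apply Subtype.ext
  apply Units.ext
  refine Matrix.ext fun i j => mixedSpace_ext (↥(maximalRealSubfield L)) L (IsCMField.complexConj L)
    (IsCMField.complexConj_ne_one L) (complexConj_smul_infinitePlace L) fun w => ?_
  rw [coe_archDiagTorus_apply, coe_rationalToArch]
  change (mixedEmbedding L (((g : GL (Fin N) L) : Matrix (Fin N) (Fin N) L) i j)).2 w = _
  rw [mixedEmbedding_apply_isComplex, hg, Matrix.smul_apply, Matrix.one_apply, smul_eq_mul, mul_ite, mul_one, mul_zero]
  by_cases hij : i = j
  · subst hij; simp
  · simp [hij]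

/-- The scalar criterion: `ζ̄ ζ = 1` in the CM field (`ζ ∈ U(1)(L⁺)`) gives `|σ_w(ζ)| = 1` at every complex place (`σ_w ∘ c = conj ∘ σ_w`, Mathlib
`IsCMField.complexEmbedding_complexConj`). [cite: Rogawski1990, §14.5 p. 239] -/
theorem norm_embedding_eq_one_of_complexConj_mul_self (ζ : L) (hζ : (IsCMField.complexConj L ζ : L) * ζ = 1)
    (w : {w : InfinitePlace L // IsComplex w}) : ‖w.1.embedding ζ‖ = 1 := by
  have h1 : starRingEnd ℂ (w.1.embedding ζ) * w.1.embedding ζ = 1 := by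
    rw [← IsCMField.complexEmbedding_complexConj L w.1.embedding ζ, ← map_mul, hζ, map_one]
  have h2 : ‖w.1.embedding ζ‖ ^ 2 = 1 := by
    have := congrArg (fun x : ℂ => ‖x‖) h1
    simpa [norm_mul, Complex.norm_conj, sq] using this
  nlinarith [norm_nonneg (w.1.embedding ζ), h2]

end CM2

end UnitaryGroup

end Literature.NumberTheory.Automorphic

end
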